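import Summits.AtomisticToContinuum.HydrodynamicLimit.Theses.VitaliAmplitudeTransfer
import Summits.AtomisticToContinuum.HydrodynamicLimit.Theorems.VitaliAmplitudeTransferAmplitudeTransfer
import Summits.AtomisticToContinuum.HydrodynamicLimit.Theorems.VitaliAmplitudeTransferLocalGibbsStatics

/-!
# Route VitaliAmplitudeTransfer — the assembly item

The assembly `Assembly` of route `route-AtomisticToContinuum-VitaliAmplitudeTransfer` is pure
logic.  Since the route repair of 2026-08-16 (rev 2, item stmt-AtomisticToContinuum-16171) it is the
CRUX-ONLY chain `UniformAmplitudeAnalyticity → NearEquilibriumLimit → FieldVarianceBound →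
AnalyticPreShockPaths → HydrodynamicLimit`: the two supports `LocalGibbsStatics` and
`AmplitudeTransfer` are no longer antecedents but are PROVED in the tree
(`localGibbsStatics_proof`, `amplitudeTransfer_proof`) and are discharged inside the proof.  The
typed glue `AmplitudeTransfer` applied to the four crux hypotheses and the proved statics yields the
unguarded Literature conjecture `Literature.MathematicalPhysics.KineticTheory.HydrodynamicLimit`,
which implies the sub-problem statement `_root_.HydrodynamicLimit` (packing-guarded since the
statement re-type of 2026-08-16, D-0032) by `HydrodynamicLimit.of_unguarded` (take any threshold,
ignore the guard).
(The rev-1 form, item stmt-AtomisticToContinuum-11876, listed the two supports among its own six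
antecedents and was closed by the same-named theorem applying the sixth to the first five.)
-/

namespace Summit.AtomisticToContinuum.HydrodynamicLimit.Theorems

open Summit.AtomisticToContinuum.HydrodynamicLimit.Theses.VitaliAmplitudeTransfer

/-- The assembly of route `VitaliAmplitudeTransfer` (item stmt-AtomisticToContinuum-16171): the chain
`UniformAmplitudeAnalyticity → NearEquilibriumLimit → FieldVarianceBound → AnalyticPreShockPaths →
HydrodynamicLimit` holds by applying the proved glue `amplitudeTransfer_proof` to the four
hypotheses and the proved statics `localGibbsStatics_proof`, then passing from the unguarded
Literature conjecture to the packing-guarded sub-problem statement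
(`HydrodynamicLimit.of_unguarded`). -/
theorem vitaliAmplitudeTransfer_assembly_proof :
    Summit.AtomisticToContinuum.HydrodynamicLimit.Theses.VitaliAmplitudeTransfer.Assembly := by
  unfold Assembly
  intro h₁ h₂ h₃ h₄
  exact _root_.HydrodynamicLimit.of_unguarded
    (amplitudeTransfer_proof h₁ h₂ h₃ h₄ localGibbsStatics_proof)

end Summit.AtomisticToContinuum.HydrodynamicLimit.Theorems
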